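import Summits.Parity.BatemanHorn.Theorems.SoloInformedQuadraticUpperBound
import Summits.Parity.BatemanHorn.Theorems.SoloInformedQuadraticPrimeCount
import Summits.Parity.BatemanHorn.Theorems.SoloInformedGeneralPolynomialSplit

/-!
# The unconditional window for `ψ_g` and for the large-divisor sum of a quadratic polynomial

Solo unit `solo-Parity-informed` (ideation tier, informed mode), session 12; `PLAN.md` §20.5, CLAIMS C56.

Notation (informal), for one polynomial `g ∈ ℤ[X]` forming a Bateman–Horn system, `C = C(g)` its
Bateman–Horn constant: `θ_g(x) = ∑_{n ≤ x, |g(n)| prime} log |g(n)|`, `ψ_g(x) = ∑_{n ≤ x} Λ(|g(n)|)`,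
and for a cut `y = y(x)` the large-divisor Möbius–log sum
`T_g(x; y) = ∑_{n ≤ x} ∑_{d ∣ |g(n)|, d > y} μ(d) log d`. The Bateman–Horn conjecture for `g` is
`ψ_g(x) ~ C x`, equivalently `T_g(x; y) = o(x)` for every admissible cut (`SoloInformedGeneralPolynomialSplit`,
`SoloInformedQuadraticPrimeCount`). Unconditionally:

* `eventually_largeDivisorSum_le_of_cut` — `T_g(x; y) ≤ (C + δ) x` eventually, for EVERY Bateman–Horn
  polynomial of degree `≥ 2` and every admissible cut (`ψ_g ≥ 0` in the identity `ψ_g - C x + T_g = o(x)`);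
* `eventually_theta_le_of_natDegree_two`, `eventually_psi_le_of_natDegree_two` — for `deg g = 2`:
  `θ_g(x), ψ_g(x) ≤ (4C + δ) x` eventually, from the sieve bound `π_g ≤ (2C + o(1)) x/log x`
  (`SoloInformedQuadraticUpperBound`), partial summation, and `PP_g = o(x)` (`SoloInformedQuadraticPrimeCount`);
* `eventually_neg_le_largeDivisorSum_of_natDegree_two` — for `deg g = 2`: `-(3C + δ) x ≤ T_g(x; y)`
  eventually; `eventually_largeDivisorSum_mem_window_rpowCut_of_natDegree_two` — both walls at the cut
  `y = ⌊x^{1-ε}⌋`.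

So for every quadratic Bateman–Horn polynomial the unconditional window is
`-(3C + o(1)) x ≤ T_g(x; x^{1-ε}) ≤ (C + o(1)) x`, and Bateman–Horn for `g` is `T_g = o(x)`: the exact
analogue of the `n² + 1` picture (`SoloInformedUpperBoundWindow`), with the same factor `4` of the
one-dimensional upper-bound sieve at level `x^{1-o(1)} = |g(n)|^{1/2-o(1)}`.

References: H. Halberstam, H.-E. Richert, *Sieve Methods* (Academic Press 1974) Thm 5.3; P. T. Bateman,
R. A. Horn, Math. Comp. 16 (1962) 363–367 [BatemanHorn1962]; E. Bombieri, *The asymptotic sieve*,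
Rend. Accad. Naz. XL (5) 1/2 (1975/76) 243–269.
-/

namespace Summit.Parity.BatemanHorn.Theorems

open Finset Filter ArithmeticFunction Asymptotics Polynomial
open scoped ArithmeticFunction.Moebius Topology
open Literature.NumberTheory.Sieve (polyRootCountMod IsBatemanHornSystem batemanHornConst polyPrimeCount)

/-! ### The upper wall `T_g ≤ (C + δ) x` (every degree `≥ 2`) -/

/-- **`T_g(x; y) ≤ (C(g) + δ) x` eventually**, for every Bateman–Horn polynomial `g` of degree `≥ 2`, every
admissible cut `y → ∞`, `y log y = o(x)`, and every `δ > 0`: in the identity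
`(ψ_g(x) - C x) + T_g(x; y) = (main-term error) = o(x)` (`sum_vonMangoldt_polyVal_sub_add_largeDivisorSum_eq`,
`polyMainError_isLittleO_of_cut`) one has `ψ_g ≥ 0`. -/
theorem eventually_largeDivisorSum_le_of_cut {g : ℤ[X]} (hg : IsBatemanHornSystem ![g])
    (hdeg : 2 ≤ g.natDegree) {y : ℕ → ℕ} (hy : Tendsto y atTop atTop)
    (hy' : (fun x : ℕ => Real.log (y x) * (y x : ℝ)) =o[atTop] fun x : ℕ => (x : ℝ)) {δ : ℝ} (hδ : 0 < δ) :
    ∀ᶠ x : ℕ in atTop,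
      ∑ n ∈ Icc 1 x,
          ∑ e ∈ ((g.eval (n : ℤ)).natAbs).divisors with y x < (g.eval (n : ℤ)).natAbs / e,
            (μ ((g.eval (n : ℤ)).natAbs / e) : ℝ) * Real.log ((((g.eval (n : ℤ)).natAbs / e : ℕ)) : ℝ)
        ≤ (batemanHornConst ![g] + δ) * x := by
  have hirr : Irreducible g := by simpa using hg.irreducible 0
  have hg0 : ∀ n : ℕ, g.eval (n : ℤ) ≠ 0 := eval_natCast_ne_zero_of_irreducible hirr hdeg
  have hE := (polyMainError_isLittleO_of_cut hg hy hy').bound hδ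
  filter_upwards [hE] with x hx
  have hid := sum_vonMangoldt_polyVal_sub_add_largeDivisorSum_eq g hg0 x (y x) (batemanHornConst ![g])
  rw [Real.norm_eq_abs, Real.norm_natCast] at hx
  have h1 := (abs_le.mp hx).2
  have hψ : 0 ≤ ∑ n ∈ Icc 1 x, Λ (g.eval (n : ℤ)).natAbs := sum_nonneg fun n _ => vonMangoldt_nonneg
  linarith

/-! ### `θ_g, ψ_g ≤ (4C + δ) x` for quadratics -/

/-- **`θ_g(x) ≤ (4 C(g) + δ) x` eventually** for a quadratic Bateman–Horn polynomial: partial summation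
(`eventually_weightedSum_le_of_card_le`, weights `log |g(n)| = 2 log n + O(1)`) of the sieve bound
`#{n ≤ x : |g(n)| prime} ≤ π_g(x) + n₀ ≤ (2C + o(1)) x/log x` (`eventually_polyPrimeCount_le_of_natDegree_two`). -/
theorem eventually_theta_le_of_natDegree_two {g : ℤ[X]} (hg : IsBatemanHornSystem ![g])
    (hdeg : g.natDegree = 2) {δ : ℝ} (hδ : 0 < δ) :
    ∀ᶠ x : ℕ in atTop,
      ∑ n ∈ (Icc 1 x).filter (fun n : ℕ => Nat.Prime (g.eval (n : ℤ)).natAbs),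
          Real.log (((g.eval (n : ℤ)).natAbs : ℕ) : ℝ) ≤ (4 * batemanHornConst ![g] + δ) * x := by
  obtain ⟨𝔠, h𝔠def⟩ : ∃ 𝔠 : ℝ, 𝔠 = batemanHornConst ![g] := ⟨_, rfl⟩
  have h𝔠 : 0 < 𝔠 := by rw [h𝔠def]; exact (IsBatemanHornSystem.hasBatemanHornConst_holds hg).2
  rw [← h𝔠def]
  have hdeg0 : 0 < g.natDegree := by omega
  have hlc : 0 < g.leadingCoeff := by simpa using hg.leadingCoeff_pos 0
  obtain ⟨B, hB⟩ := exists_abs_log_natAbs_eval_sub_le hdeg0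
  have hB' : ∀ n : ℕ, 1 ≤ n → |Real.log (((g.eval (n : ℤ)).natAbs : ℕ) : ℝ) - 2 * Real.log n| ≤ B := by
    intro n hn
    have h := hB n hn
    rwa [hdeg, Nat.cast_ofNat] at h
  obtain ⟨n₀, hpos⟩ := exists_eval_natCast_pos hdeg0 hlc
  -- `#{1 ≤ n ≤ x : |g(n)| prime} ≤ (1 + c) (2𝔠) x / log x` eventually, for every `c > 0`
  have hP : ∀ c : ℝ, 0 < c → ∀ᶠ x : ℕ in atTop,
      (#((Icc 1 x).filter fun n : ℕ => Nat.Prime (g.eval (n : ℤ)).natAbs) : ℝ)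
        ≤ (1 + c) * (4 * 𝔠 / 2 * x / Real.log x) := by
    intro c hc
    have h1 := eventually_polyPrimeCount_le_of_natDegree_two hg hdeg (δ := 𝔠 * c) (by positivity)
    rw [← h𝔠def] at h1
    have h2 := (tendsto_const_mul_div_log_atTop (K := 𝔠 * c) (by positivity)).eventually_ge_atTop (n₀ : ℝ)
    filter_upwards [h1, h2] with x hx1 hx2
    have h3 : (#((Icc 1 x).filter fun n : ℕ => Nat.Prime (g.eval (n : ℤ)).natAbs) : ℝ)
        ≤ (polyPrimeCount ![g] x : ℝ) + n₀ := by
      exact_mod_cast card_le_polyPrimeCount_add g hpos x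
    have e : (1 + c) * (4 * 𝔠 / 2 * x / Real.log x)
        = (2 * 𝔠 + 𝔠 * c) * x / Real.log x + 𝔠 * c * x / Real.log x := by ring
    rw [e]
    linarith
  have hW := eventually_weightedSum_le_of_card_le
    (p := fun n : ℕ => Nat.Prime (g.eval (n : ℤ)).natAbs)
    (w := fun n : ℕ => Real.log (((g.eval (n : ℤ)).natAbs : ℕ) : ℝ)) (d := 2) (C := 4 * 𝔠)
    two_pos (by positivity) hB' hP (δ / (4 * 𝔠)) (by positivity)
  filter_upwards [hW] with x hx
  have e : (1 + δ / (4 * 𝔠)) * (4 * 𝔠 * (x : ℝ)) = (4 * 𝔠 + δ) * x := by field_simp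
  rw [e] at hx
  exact hx

/-- **`ψ_g(x) = ∑_{n ≤ x} Λ(|g(n)|) ≤ (4 C(g) + δ) x` eventually** for a quadratic Bateman–Horn polynomial
(`ψ_g = θ_g + PP_g`, `PP_g = o(x)` by `properPrimePow_sum_isLittleO_of_natDegree_two`). -/
theorem eventually_psi_le_of_natDegree_two {g : ℤ[X]} (hg : IsBatemanHornSystem ![g])
    (hdeg : g.natDegree = 2) {δ : ℝ} (hδ : 0 < δ) :
    ∀ᶠ x : ℕ in atTop, ∑ n ∈ Icc 1 x, Λ (g.eval (n : ℤ)).natAbs ≤ (4 * batemanHornConst ![g] + δ) * x := by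
  have hθ := eventually_theta_le_of_natDegree_two hg hdeg (half_pos hδ)
  have hPP := (properPrimePow_sum_isLittleO_of_natDegree_two hg hdeg).bound (half_pos hδ)
  filter_upwards [hθ, hPP] with x hθx hPPx
  rw [Real.norm_of_nonneg (sum_nonneg fun n _ => vonMangoldt_nonneg), Real.norm_natCast] at hPPx
  rw [sum_vonMangoldt_polyVal_eq_theta_add]
  linarith

/-! ### The lower wall `-(3C + δ) x ≤ T_g` for quadratics, and the window -/

/-- **`-(3 C(g) + δ) x ≤ T_g(x; y)` eventually** for a quadratic Bateman–Horn polynomial and every admissible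
cut: `T_g = (C x - ψ_g) + o(x)` and `ψ_g ≤ (4C + o(1)) x`. -/
theorem eventually_neg_le_largeDivisorSum_of_natDegree_two {g : ℤ[X]} (hg : IsBatemanHornSystem ![g])
    (hdeg : g.natDegree = 2) {y : ℕ → ℕ} (hy : Tendsto y atTop atTop)
    (hy' : (fun x : ℕ => Real.log (y x) * (y x : ℝ)) =o[atTop] fun x : ℕ => (x : ℝ)) {δ : ℝ} (hδ : 0 < δ) :
    ∀ᶠ x : ℕ in atTop,
      -(3 * batemanHornConst ![g] + δ) * x ≤
        ∑ n ∈ Icc 1 x,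
          ∑ e ∈ ((g.eval (n : ℤ)).natAbs).divisors with y x < (g.eval (n : ℤ)).natAbs / e,
            (μ ((g.eval (n : ℤ)).natAbs / e) : ℝ) * Real.log ((((g.eval (n : ℤ)).natAbs / e : ℕ)) : ℝ) := by
  have hirr : Irreducible g := by simpa using hg.irreducible 0
  have hg0 : ∀ n : ℕ, g.eval (n : ℤ) ≠ 0 := eval_natCast_ne_zero_of_irreducible hirr hdeg.ge
  have hE := (polyMainError_isLittleO_of_cut hg hy hy').bound (half_pos hδ)
  filter_upwards [hE, eventually_psi_le_of_natDegree_two hg hdeg (half_pos hδ)] with x hx hψ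
  have hid := sum_vonMangoldt_polyVal_sub_add_largeDivisorSum_eq g hg0 x (y x) (batemanHornConst ![g])
  rw [Real.norm_eq_abs, Real.norm_natCast] at hx
  have h1 := (abs_le.mp hx).1
  linarith

/-- **The unconditional window at the cut `⌊x^{1-ε}⌋`** (`0 < ε < 1`, `deg g = 2`): for every `δ > 0`,
eventually `-(3 C(g) + δ) x ≤ T_g(x; ⌊x^{1-ε}⌋) ≤ (C(g) + δ) x`. Bateman–Horn for `g` is `T_g = o(x)`
(`batemanHornAsymptotic_iff_largeDivisorSum_isLittleO_rpowCut_of_natDegree_two`). -/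
theorem eventually_largeDivisorSum_mem_window_rpowCut_of_natDegree_two {g : ℤ[X]}
    (hg : IsBatemanHornSystem ![g]) (hdeg : g.natDegree = 2) {ε : ℝ} (hε : 0 < ε) (hε1 : ε < 1)
    {δ : ℝ} (hδ : 0 < δ) :
    ∀ᶠ x : ℕ in atTop,
      -(3 * batemanHornConst ![g] + δ) * x ≤
          ∑ n ∈ Icc 1 x,
            ∑ e ∈ ((g.eval (n : ℤ)).natAbs).divisors with ⌊(x : ℝ) ^ (1 - ε)⌋₊ < (g.eval (n : ℤ)).natAbs / e,
              (μ ((g.eval (n : ℤ)).natAbs / e) : ℝ) * Real.log ((((g.eval (n : ℤ)).natAbs / e : ℕ)) : ℝ)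
        ∧ ∑ n ∈ Icc 1 x,
            ∑ e ∈ ((g.eval (n : ℤ)).natAbs).divisors with ⌊(x : ℝ) ^ (1 - ε)⌋₊ < (g.eval (n : ℤ)).natAbs / e,
              (μ ((g.eval (n : ℤ)).natAbs / e) : ℝ) * Real.log ((((g.eval (n : ℤ)).natAbs / e : ℕ)) : ℝ)
          ≤ (batemanHornConst ![g] + δ) * x := by
  have hy := tendsto_floor_rpow_atTop (by linarith : (0 : ℝ) < 1 - ε)
  have hy' := rpowCut_mul_log_isLittleO hε hε1
  filter_upwards [eventually_neg_le_largeDivisorSum_of_natDegree_two hg hdeg hy hy' hδ,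
    eventually_largeDivisorSum_le_of_cut hg hdeg.ge hy hy' hδ] with x h1 h2
  exact ⟨h1, h2⟩

end Summit.Parity.BatemanHorn.Theorems
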